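import Summits.QuantumAdvantage.AdviceFreeQNC0.AffBells36PairAlignedHard
import Summits.QuantumAdvantage.AdviceFreeQNC0.BondTwistLocal
import HarnessLib

/-!
# Exp38p2 — the CONSTANT-DEFECT INVERSE THEOREM `ThetaAligned` (= p1's `NearPerfectAligned` at constant defect) and the glue
# `ThetaAligned → RingAffineBellsLt3` through the TREE THEOREM `AffBells36.PairSkel.pairAlignedHard`

Cell qa-qnc0, planner qa-qnc0-p2 g38 (memo `HOME/qa-qnc0-p2/ROUND-38P2.md` §3.7.1, N8).  Tree port (qn-prover-3 g25) of the custody file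
`qa-qnc0-p2/exp38p2/ThetaAligned38.lean` (sha b47acbf4d66327e6), verbatim; D-0168 E1: no ledger item, evidence on `stmt-QuantumAdvantage-22907`.
`ThetaAligned` is a CONJECTURE (typed, unproved): every affine MOD₃ bell strategy winning more than `θ₀·2^{N−1}` odd inputs is pair-aligned with one
coefficient sequence `γ` (non-zero on an adjacent pairing of linear size) at all but `(log₂ N)^C` pairs per row.  With the landed analytic box
`pairAlignedHard` it gives the affine constant-fraction rung `BondTwist3.RingAffineBellsLt3` (`ringAffineBellsLt3_of_thetaAligned`, PROVED here, sorry-free).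
WHAT THIS IS NOT: `ThetaAligned` is open; nothing on `RingHardOdd 3`.
-/

noncomputable section

open Classical

namespace Summit.QuantumAdvantage.AdviceFreeQNC0.Exp38p2

open Finset Literature.Computability.QuantumComplexity Literature.Computability.QuantumComplexity.RingHLF
open AffBells23 AffBells36

/-- **`ThetaAligned` (CONJECTURE — the constant-defect inverse theorem for affine bells).** -/
def ThetaAligned : Prop :=
  ∃ θ₀ : ℝ, θ₀ < 1 ∧ ∃ c₀ C n₀ : ℕ, ∀ N ≥ n₀, ∀ (β : Fin N → Fin N → ZMod 3) (c : Fin N → ZMod 3),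
    θ₀ * (2 : ℝ) ^ (N - 1) < (affWinCard β c : ℝ) →
      ∃ (γ : Fin N → ZMod 3) (P : Finset (Fin N)), IsPairing P ∧ N ≤ c₀ * P.card ∧ (∀ j ∈ P, γ j ≠ 0) ∧
        (∀ j ∈ P, ∀ hj : j.val + 1 < N, γ ⟨j.val + 1, hj⟩ ≠ 0) ∧ ∀ k, (misaligned β γ P k).card ≤ (Nat.log 2 N) ^ C

/-- **`PairAlignedHard → ThetaAligned → RingAffineBellsLt3`** (two-line glue: a strategy beating `max θ₀ θ₁` is aligned, hence loses). -/
theorem ringAffineBellsLt3_of_thetaAligned' (hH : PairAlignedHard) (hA : ThetaAligned) : BondTwist3.RingAffineBellsLt3 := by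
  obtain ⟨θ₀, hθ₀, c₀, C, n₀, hal⟩ := hA
  obtain ⟨θ₁, hθ₁, hhard⟩ := hH c₀
  obtain ⟨n₁, hn₁⟩ := hhard C
  refine ⟨max θ₀ θ₁, max_lt hθ₀ hθ₁, max n₀ n₁, fun N hN β c => ?_⟩
  have hNn₀ : n₀ ≤ N := le_trans (le_max_left _ _) hN
  have hNn₁ : n₁ ≤ N := le_trans (le_max_right _ _) hN
  -- the filter in `RingAffineBellsLt3` is `affWinCard β c`
  have hcard : (univ.filter fun x : Fin N → Bool =>
      OddZeros x ∧ RingHLF.Rel x (fun k => decide ((∑ i : Fin N, if x i then β k i else 0) = c k))).card = affWinCard β c := by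
    unfold affWinCard affBell; rfl
  rw [hcard]
  by_contra hW
  rw [not_le] at hW
  have h2pos : (0 : ℝ) < (2 : ℝ) ^ (N - 1) := pow_pos (by norm_num) _
  have hW₀ : θ₀ * (2 : ℝ) ^ (N - 1) < (affWinCard β c : ℝ) :=
    lt_of_le_of_lt (mul_le_mul_of_nonneg_right (le_max_left _ _) h2pos.le) hW
  obtain ⟨γ, P, hP, hPc, hγ0, hγ1, hmis⟩ := hal N hNn₀ β c hW₀
  have hbound := hn₁ N hNn₁ β c γ P hP hPc hγ0 hγ1 hmis
  have : θ₁ * (2 : ℝ) ^ (N - 1) ≤ max θ₀ θ₁ * (2 : ℝ) ^ (N - 1) :=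
    mul_le_mul_of_nonneg_right (le_max_right _ _) h2pos.le
  linarith

/-- Unconditional in the analytic box: **`ThetaAligned → RingAffineBellsLt3`** (uses the tree theorem `PairSkel.pairAlignedHard`). -/
theorem ringAffineBellsLt3_of_thetaAligned (hA : ThetaAligned) : BondTwist3.RingAffineBellsLt3 :=
  ringAffineBellsLt3_of_thetaAligned' PairSkel.pairAlignedHard hA

end Summit.QuantumAdvantage.AdviceFreeQNC0.Exp38p2

end
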